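import Summits.QuantumFields.BalabanUV.T4Continuum.Spine.NE9.DirectPairingApexCGFSharp
import Mathlib.Analysis.Complex.ExponentialBounds

/-!
# T⁴ programme, spine estimate NE9 — THE RATE AT THE APEX: THE LOGARITHM IN THE CUMULANT-GENERATING-FUNCTION CURRENCY, THE LAWS AND THE VERDICTS
# (positivity does not rescue a constant factor) — census item C46 (b) of cell `pub-balaban-gaps`, seat ne9 (gen 15), sequel file

Cell `pub-balaban-gaps` (YM blitz G2, seat ne9, unit `pub-balaban-gaps-ne9-g15`; record `run/shared/lean/pub/pub-balaban-gaps/ne/NE9.md` §5 row C46).  Sequel to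
`DirectPairingApexCGFSharp` (the Müntz–Chebyshev exponential sum `P(t) = e^{−t∕2}·T_N((e^{t∕N} − 1)∕h) = Σ_k a_k e^{t x_k}` on the nodes `x_k = k∕N − 1∕2`,
`h = e^{l∕N} − 1`: `∣P∣ ≤ e^{l∕2}` on `[−l, l]`, `Σ a_k = 0`, `∣Σ a_k x_k∣ = 1∕h`, `∣a_k∣ ≤ (4∕h+1)^N`).  This file builds the two LAWS and reads off the verdicts:
`p_k = 1∕(N+1)` (uniform on the nodes) and `p′_k = p_k + η·a_k`, a probability law while `2η(N+1)(4∕h+1)^N ≤ 1`; their cumulant generating functions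
`cgf_p(t) = log Σ p_k e^{t x_k}`, `cgf_{p′}` differ by `log(1 + ηP(t)∕M_p(t))`, `M_p ≥ e^{−l∕2}`, hence by AT MOST `6η` on `∣t∣ ≤ l`, while the means differ by
EXACTLY `η∕h ≥ N·η∕(3l)`.  So in the CGF currency of `DirectPairingApexAnalyticScheme.expectAt_rate_of_king_analytic` — differences of cumulant generating
functions of observables bounded by `1`, WITH positivity — NO constant loss factor is possible (`no_constant_lossFactor_cgf`): the apex loss is unbounded, and
by the admissibility threshold `η ≍ e^{−N log(4N∕l)}` (i.e. `N ≍ log η⁻¹∕log log η⁻¹`) the logarithm of C45 (c) is necessary there up to a `log log`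
(whether positivity gains that `log log` is not settled).
* `abs_log_sum_sub_log_sum_le` (`∣cgf_{p′}(t) − cgf_p(t)∣ ≤ 6η` on `∣t∣ ≤ l`), `hasDerivAt_cgf_sub_zero` (the derivative at `0` of the cgf difference IS the
  difference of the means `Σ (p′_k − p_k) x_k`), **`cgf_log_loss_witness`** (lattice form: positive weights, total mass `1`, nodes in `[−1∕2, 1∕2]`, cgf's
  `6η`-close on the window, means `η∕h` apart), `inv_expm1_ge` (`1∕(e^{s} − 1) ≥ 1∕(3s)` on `]0, 1]`), **`no_constant_lossFactor_cgf`** (for every `C`: a pair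
  with `∣Δmean∣ > C·sup∣Δcgf∣∕l`).

HONEST FRAMING: MODEL-level real analysis on hypothesis SHAPES (label MODEL) for rung (B)+1 bookkeeping on ONE FIXED finite four-torus; NO definition; the laws
are finitely supported laws of a `[−1∕2, 1∕2]`-valued observable written as explicit finite sums (no TorusScheme ∕ Gibbs realisation on the gauge configuration
space is constructed or claimed); no statement about Bałaban's d = 4 procedure is made here; NOTHING new is owed by the E-side; CLASSIFICATION OF NE9 UNCHANGED:
WORK-bound (W1 = the one-step renormalization transformation as a Lean object; instance 0∕1); NE9 NOT PRINTED ∕ NOT PROVED; spine PROVED 0∕9 unchanged; NOT UV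
stability, NOT the continuum limit, NOT infinite volume, NOT a mass gap, NOT Clay.

References (TYPES only): Newman's inequality ∕ Müntz–Chebyshev extremisers (P. Borwein–T. Erdélyi, *Polynomials and Polynomial Inequalities*, GTM 161 (1995),
§6.1) — no statement of theirs is asserted; Mathlib's `Real.abs_log_sub_add_sum_range_le`, `Real.add_one_le_exp`, `HasDerivAt.log` consumed BY NAME.
-/

namespace Summit.QuantumFields.BalabanUV.T4Continuum.NE9.DirectPairingApexCGFSharpLaws

open Real Set Filter Topology Finset Polynomial Polynomial.Chebyshev
open Summit.QuantumFields.BalabanUV.T4Continuum.NE9.DirectPairingApexCGFSharp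

/-! ## §3 The two laws `p = uniform`, `p′ = p + η·a` on the nodes, and the verdicts -/

section Laws

variable {l η : ℝ} {N : ℕ}

/-- **THE CGF DIFFERENCE IS `O(η)` ON THE WINDOW.**  Nodes `x_k = k∕N − 1∕2`, weights `p_k = 1∕(N+1)` and `p′_k = p_k + η·a_k` with the Müntz–Chebyshev
coefficients `a_k` (`h = e^{l∕N} − 1`): for `0 < l ≤ 1`, `N` odd, `0 ≤ η`, `2η·e ≤ 1` and `∣t∣ ≤ l`,
`∣log Σ p′_k e^{t x_k} − log Σ p_k e^{t x_k}∣ ≤ 6η` (the ratio is `1 + ηP(t)∕M(t)` with `∣P∣ ≤ e^{l∕2}`, `M ≥ e^{−l∕2}`, `∣log(1+u)∣ ≤ 2∣u∣`). [folklore] -/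
theorem abs_log_sum_sub_log_sum_le (hl : 0 < l) (hl1 : l ≤ 1) (hN : Odd N) (hη : 0 ≤ η) (hηe : 2 * η * Real.exp 1 ≤ 1)
    {t : ℝ} (ht : |t| ≤ l) :
    |Real.log (∑ k ∈ range (N + 1), (1 / (N + 1 : ℝ) + η * ((T ℝ N).comp (C (Real.exp (l / N) - 1)⁻¹ * (X - C 1))).coeff k) *
          Real.exp (t * ((k : ℝ) / N - 1 / 2))) -
        Real.log (∑ k ∈ range (N + 1), 1 / (N + 1 : ℝ) * Real.exp (t * ((k : ℝ) / N - 1 / 2)))| ≤ 6 * η := by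
  have hNpos := hN.pos
  set h : ℝ := Real.exp (l / N) - 1 with hh
  set R : ℝ[X] := (T ℝ N).comp (C h⁻¹ * (X - C 1)) with hR
  set M : ℝ := ∑ k ∈ range (N + 1), 1 / (N + 1 : ℝ) * Real.exp (t * ((k : ℝ) / N - 1 / 2)) with hM
  set P : ℝ := Real.exp (-(t / 2)) * R.eval (Real.exp (t / N)) with hP
  -- split the perturbed sum
  have hsplit : ∑ k ∈ range (N + 1), (1 / (N + 1 : ℝ) + η * R.coeff k) * Real.exp (t * ((k : ℝ) / N - 1 / 2)) = M + η * P := by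
    rw [hP, muntz_eq_sum hNpos h t, hM, mul_sum, ← sum_add_distrib]
    refine sum_congr rfl fun k _ => ?_
    ring
  -- `M ≥ e^{−l∕2} > 0`
  obtain ⟨ht1, ht2⟩ := abs_le.mp ht
  have hterm : ∀ k ∈ range (N + 1), Real.exp (-(l / 2)) ≤ Real.exp (t * ((k : ℝ) / N - 1 / 2)) := by
    intro k hk
    apply Real.exp_le_exp.mpr
    have hk' : (k : ℝ) ≤ N := by exact_mod_cast Nat.lt_succ_iff.mp (mem_range.mp hk)
    have hx : |(k : ℝ) / N - 1 / 2| ≤ 1 / 2 := by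
      rw [abs_le]
      have hNr : (0 : ℝ) < N := Nat.cast_pos.mpr hNpos
      constructor
      · have : 0 ≤ (k : ℝ) / N := by positivity
        linarith
      · have : (k : ℝ) / N ≤ 1 := (div_le_one hNr).mpr hk'
        linarith
    have := abs_mul t ((k : ℝ) / N - 1 / 2)
    have h2 : |t| * |(k : ℝ) / N - 1 / 2| ≤ l * (1 / 2) := mul_le_mul ht hx (abs_nonneg _) hl.le
    have h3 := neg_abs_le (t * ((k : ℝ) / N - 1 / 2))
    rw [this] at h3
    linarith
  have hMge : Real.exp (-(l / 2)) ≤ M := by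
    have hsum := sum_le_sum fun k hk => mul_le_mul_of_nonneg_left (hterm k hk) (by positivity : (0 : ℝ) ≤ 1 / (N + 1 : ℝ))
    rw [sum_const, card_range, nsmul_eq_mul] at hsum
    have e : ((N + 1 : ℕ) : ℝ) * (1 / (N + 1 : ℝ) * Real.exp (-(l / 2))) = Real.exp (-(l / 2)) := by
      push_cast
      field_simp
    rw [e] at hsum
    exact hsum
  have hMpos : 0 < M := lt_of_lt_of_le (Real.exp_pos _) hMge
  -- `∣P∣ ≤ e^{l∕2}`
  have hPle : |P| ≤ Real.exp (l / 2) := by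
    rw [hP, abs_mul, Real.abs_exp]
    have h1 : Real.exp (-(t / 2)) ≤ Real.exp (l / 2) := Real.exp_le_exp.mpr (by linarith)
    have h2 := abs_cheb_comp_exp_le_one hl hNpos ht
    rw [← hh] at h2
    calc Real.exp (-(t / 2)) * |R.eval (Real.exp (t / N))| ≤ Real.exp (l / 2) * 1 :=
          mul_le_mul h1 h2 (abs_nonneg _) (Real.exp_pos _).le
      _ = Real.exp (l / 2) := mul_one _
  -- `u = ηP∕M`, `∣u∣ ≤ η·e ≤ 1∕2`
  set u : ℝ := η * P / M with hu
  have hule : |u| ≤ η * Real.exp 1 := by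
    rw [hu, abs_div, abs_mul, abs_of_nonneg hη, abs_of_pos hMpos, div_le_iff₀ hMpos]
    have h1 : η * |P| ≤ η * Real.exp (l / 2) := mul_le_mul_of_nonneg_left hPle hη
    have h2 : Real.exp (l / 2) = Real.exp 1 * Real.exp (-(l / 2)) * Real.exp (l - 1) := by
      rw [← Real.exp_add, ← Real.exp_add]; congr 1; ring
    have h3 : Real.exp (l - 1) ≤ 1 := Real.exp_le_one_iff.mpr (by linarith)
    have h4 : Real.exp (l / 2) ≤ Real.exp 1 * Real.exp (-(l / 2)) := by
      rw [h2]
      exact mul_le_of_le_one_right (by positivity) h3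
    calc η * |P| ≤ η * (Real.exp 1 * Real.exp (-(l / 2))) := h1.trans (mul_le_mul_of_nonneg_left h4 hη)
      _ = η * Real.exp 1 * Real.exp (-(l / 2)) := by ring
      _ ≤ η * Real.exp 1 * M := mul_le_mul_of_nonneg_left hMge (by positivity)
  have hu2 : |u| ≤ 1 / 2 := hule.trans (by linarith)
  -- the difference of logarithms is `log(1+u)`
  have hsum' : M + η * P = M * (1 + u) := by
    rw [hu]
    field_simp
  have h1u : 0 < 1 + u := by
    have := neg_abs_le u
    linarith
  rw [hsplit, hsum', Real.log_mul hMpos.ne' h1u.ne', add_sub_cancel_left]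
  -- `∣log(1 + u)∣ ≤ 2∣u∣` for `∣u∣ ≤ 1∕2` (Mathlib's `Real.abs_log_sub_add_sum_range_le` with no Taylor terms; re-derived inline — the tree has it under
  -- topic-foreign modules)
  have hlog : |Real.log (1 + u)| ≤ 2 * |u| := by
    have h := Real.abs_log_sub_add_sum_range_le (x := -u) (by rw [abs_neg]; linarith) 0
    simp only [range_zero, sum_empty, zero_add, sub_neg_eq_add, abs_neg, pow_one] at h
    calc |Real.log (1 + u)| ≤ |u| / (1 - |u|) := h
      _ ≤ 2 * |u| := by
          rw [div_le_iff₀ (by linarith)]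
          nlinarith [abs_nonneg u]
  calc |Real.log (1 + u)| ≤ 2 * |u| := hlog
    _ ≤ 2 * (η * Real.exp 1) := by linarith
    _ ≤ 6 * η := by nlinarith [Real.exp_one_lt_d9, hη]

/-- The derivative at `0` of the cgf difference of two laws `p, p′` (positive finite exponential sums with total mass `1`) IS the difference of the means
`Σ (p′_k − p_k)·x_k`. [folklore] -/
theorem hasDerivAt_cgf_sub_zero {p p' x : ℕ → ℝ} {n : ℕ} (hs : ∑ k ∈ range n, p k = 1) (hs' : ∑ k ∈ range n, p' k = 1) :
    HasDerivAt (fun t : ℝ => Real.log (∑ k ∈ range n, p' k * Real.exp (t * x k)) - Real.log (∑ k ∈ range n, p k * Real.exp (t * x k)))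
      (∑ k ∈ range n, (p' k - p k) * x k) 0 := by
  have hd := hasDerivAt_expSum_zero p x n
  have hd' := hasDerivAt_expSum_zero p' x n
  have h0 : ∑ k ∈ range n, p k * Real.exp (0 * x k) = 1 := by simpa using hs
  have h0' : ∑ k ∈ range n, p' k * Real.exp (0 * x k) = 1 := by simpa using hs'
  have hl := hd.log (by rw [h0]; exact one_ne_zero)
  have hl' := hd'.log (by rw [h0']; exact one_ne_zero)
  rw [h0, div_one] at hl
  rw [h0', div_one] at hl'
  have e : ∑ k ∈ range n, (p' k - p k) * x k = ∑ k ∈ range n, p' k * x k - ∑ k ∈ range n, p k * x k := by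
    rw [← sum_sub_distrib]
    refine sum_congr rfl fun k _ => ?_
    ring
  rw [e]
  exact hl'.fun_sub hl

/-- **THE CGF-CURRENCY WITNESS (lattice form).**  For `0 < l ≤ 1`, `N` odd, `h = e^{l∕N} − 1` and `0 < η` with `2η(N+1)(4∕h+1)^N ≤ 1`: the laws
`p_k = 1∕(N+1)` and `p′_k = p_k + η·a_k` on the nodes `x_k = k∕N − 1∕2 ∈ [−1∕2, 1∕2]` (`k = 0…N`; `a_k` = the Müntz–Chebyshev coefficients) are probability
laws (positive weights, total mass `1`), their cumulant generating functions differ by AT MOST `6η` on `∣t∣ ≤ l`, and their means differ by EXACTLY `η∕h`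
(`≥ N·η∕(3l)`, `inv_expm1_ge`).  MODEL-level. [folklore] -/
theorem cgf_log_loss_witness (hl : 0 < l) (hl1 : l ≤ 1) (hN : Odd N) (hη : 0 < η)
    (hηN : 2 * η * (N + 1) * (4 / (Real.exp (l / N) - 1) + 1) ^ N ≤ 1) :
    ∃ x p p' : ℕ → ℝ, (∀ k ∈ range (N + 1), |x k| ≤ 1 / 2) ∧
      (∀ k ∈ range (N + 1), 0 < p k ∧ 0 < p' k) ∧
      ∑ k ∈ range (N + 1), p k = 1 ∧ ∑ k ∈ range (N + 1), p' k = 1 ∧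
      (∀ t : ℝ, |t| ≤ l →
        |Real.log (∑ k ∈ range (N + 1), p' k * Real.exp (t * x k)) - Real.log (∑ k ∈ range (N + 1), p k * Real.exp (t * x k))| ≤ 6 * η) ∧
      HasDerivAt (fun t : ℝ => Real.log (∑ k ∈ range (N + 1), p' k * Real.exp (t * x k)) -
          Real.log (∑ k ∈ range (N + 1), p k * Real.exp (t * x k))) (∑ k ∈ range (N + 1), (p' k - p k) * x k) 0 ∧
      |∑ k ∈ range (N + 1), (p' k - p k) * x k| = η / (Real.exp (l / N) - 1) := by
  have hNpos := hN.pos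
  have hNr : (0 : ℝ) < N := Nat.cast_pos.mpr hNpos
  set h : ℝ := Real.exp (l / N) - 1 with hhdef
  have hh : 0 < h := expm1_pos hl hNpos
  set a : ℕ → ℝ := fun k => ((T ℝ N).comp (C h⁻¹ * (X - C 1))).coeff k with ha
  set x : ℕ → ℝ := fun k => (k : ℝ) / N - 1 / 2 with hx
  set p : ℕ → ℝ := fun _ => 1 / (N + 1 : ℝ) with hp
  set p' : ℕ → ℝ := fun k => 1 / (N + 1 : ℝ) + η * a k with hp'
  -- the weight bound: `η∣a_k∣ ≤ 1∕(2(N+1))`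
  have hB : 0 < (4 / h + 1) ^ N := by positivity
  have hηa : ∀ k, η * |a k| ≤ 1 / (2 * (N + 1 : ℝ)) := by
    intro k
    have h1 : η * |a k| ≤ η * (4 / h + 1) ^ N := mul_le_mul_of_nonneg_left (cheb_comp_coeff_le hh N k) hη.le
    rw [le_div_iff₀ (by positivity)]
    nlinarith
  have hxk : ∀ k ∈ range (N + 1), |x k| ≤ 1 / 2 := by
    intro k hk
    have hk' : (k : ℝ) ≤ N := by exact_mod_cast Nat.lt_succ_iff.mp (mem_range.mp hk)
    rw [hx, abs_le]
    constructor
    · have : 0 ≤ (k : ℝ) / N := by positivity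
      simp only; linarith
    · have : (k : ℝ) / N ≤ 1 := (div_le_one hNr).mpr hk'
      simp only; linarith
  have hpos : ∀ k ∈ range (N + 1), 0 < p k ∧ 0 < p' k := by
    intro k _
    refine ⟨by positivity, ?_⟩
    have h1 := hηa k
    have h2 := neg_abs_le (a k)
    have h3 : -(1 / (2 * (N + 1 : ℝ))) ≤ η * a k := by nlinarith [abs_nonneg (a k)]
    have h4 : (0 : ℝ) < 1 / (N + 1 : ℝ) - 1 / (2 * (N + 1 : ℝ)) := by
      rw [sub_pos, one_div_lt_one_div (by positivity) (by positivity)]; linarith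
    show 0 < 1 / (N + 1 : ℝ) + η * a k
    linarith
  have hsum : ∑ k ∈ range (N + 1), p k = 1 := by
    rw [sum_const, card_range, nsmul_eq_mul]; push_cast; field_simp
  have hsum' : ∑ k ∈ range (N + 1), p' k = 1 := by
    simp only [hp', sum_add_distrib, ← mul_sum]
    rw [ha, sum_coeff_eq_zero hN h, mul_zero, add_zero, sum_const, card_range, nsmul_eq_mul]; push_cast; field_simp
  refine ⟨x, p, p', hxk, hpos, hsum, hsum', fun t ht => ?_, hasDerivAt_cgf_sub_zero hsum hsum', ?_⟩
  · have hηe : 2 * η * Real.exp 1 ≤ 1 := by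
      -- `e ≤ 4∕h + 1 ≤ (N+1)(4∕h+1)^N` since `h ≤ e − 1 ≤ 2`… we only need `e ≤ (N+1)(4∕h+1)^N`: `h = e^{l∕N} − 1 ≤ e − 1`, so `4∕h + 1 ≥ 4∕(e−1) + 1 ≥ e`
      have hhle : h ≤ Real.exp 1 - 1 := by
        rw [hhdef]
        have : l / N ≤ 1 := (div_le_one hNr).mpr (hl1.trans (by exact_mod_cast hNpos))
        linarith [Real.exp_le_exp.mpr this]
      have he : Real.exp 1 ≤ 4 / h + 1 := by
        have h1 : 4 / (Real.exp 1 - 1) ≤ 4 / h := div_le_div_of_nonneg_left (by norm_num) hh hhle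
        have h2 : Real.exp 1 ≤ 4 / (Real.exp 1 - 1) + 1 := by
          rw [← sub_le_iff_le_add, le_div_iff₀ (by linarith [Real.add_one_lt_exp (one_ne_zero)])]
          nlinarith [Real.exp_one_lt_d9, Real.exp_one_gt_d9]
        linarith
      have h3 : 4 / h + 1 ≤ (N + 1 : ℝ) * (4 / h + 1) ^ N := by
        have hb1 : 1 ≤ 4 / h + 1 := by linarith [div_pos four_pos hh]
        calc 4 / h + 1 = 1 * (4 / h + 1) ^ 1 := by ring
          _ ≤ (N + 1 : ℝ) * (4 / h + 1) ^ N :=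
            mul_le_mul (by linarith) (pow_le_pow_right₀ hb1 hNpos) (by positivity) (by positivity)
      calc 2 * η * Real.exp 1 ≤ 2 * η * ((N + 1 : ℝ) * (4 / h + 1) ^ N) := by nlinarith
        _ = 2 * η * (N + 1) * (4 / h + 1) ^ N := by ring
        _ ≤ 1 := hηN
    exact abs_log_sum_sub_log_sum_le hl hl1 hN hη.le hηe ht
  · have e : ∀ k, (p' k - p k) * x k = η * (a k * ((k : ℝ) / N - 1 / 2)) := fun k => by
      simp only [hp', hp, hx]; ring
    simp only [e, ← mul_sum]
    rw [abs_mul, abs_of_pos hη, ha, abs_sum_coeff_mul_node hN hh, mul_one_div]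

/-- `1∕(e^{s} − 1) ≥ 1∕(3s)` for `0 < s ≤ 1` (`e^{s} − 1 ≤ s·e^{s} ≤ e·s < 3s`); with `s = l∕N`: `η∕h ≥ N·η∕(3l)`. [folklore] -/
theorem inv_expm1_ge {s : ℝ} (hs : 0 < s) (hs1 : s ≤ 1) : 1 / (3 * s) ≤ 1 / (Real.exp s - 1) := by
  have h0 : 0 < Real.exp s - 1 := by linarith [Real.add_one_lt_exp hs.ne']
  rw [one_div_le_one_div (by positivity) h0]
  -- `e^{s} − 1 ≤ s·e^{s}`: from `1 − s ≤ e^{−s}`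
  have h1 : Real.exp s - 1 ≤ s * Real.exp s := by
    have := Real.add_one_le_exp (-s)
    have h2 : Real.exp (-s) * Real.exp s = 1 := by rw [← Real.exp_add, neg_add_cancel, Real.exp_zero]
    nlinarith [Real.exp_pos s, Real.exp_pos (-s)]
  have h3 : Real.exp s ≤ Real.exp 1 := Real.exp_le_exp.mpr hs1
  nlinarith [Real.exp_one_lt_d9, Real.exp_pos s]

/-- **NO CONSTANT LOSS FACTOR IN THE CGF CURRENCY.**  For every `C` and every `0 < l ≤ 1` there are two probability laws `p, p′` on finitely many nodes of
`[−1∕2, 1∕2]` and an `ε > 0` with `sup_{∣t∣≤l}∣cgf_{p′} − cgf_p∣ ≤ ε` but `∣mean_{p′} − mean_p∣ > C·ε∕l` — positivity of the laws does NOT rescue a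
constant-factor version of `norm_deriv_le_log`; the apex loss in this currency is unbounded (and, by the admissibility threshold of
`cgf_log_loss_witness`, the logarithm is necessary up to a `log log`).  MODEL-level. [folklore] -/
theorem no_constant_lossFactor_cgf (C : ℝ) (hl : 0 < l) (hl1 : l ≤ 1) :
    ∃ (n : ℕ) (x p p' : ℕ → ℝ) (ε : ℝ), 0 < ε ∧ (∀ k ∈ range n, |x k| ≤ 1 / 2) ∧ (∀ k ∈ range n, 0 < p k ∧ 0 < p' k) ∧
      ∑ k ∈ range n, p k = 1 ∧ ∑ k ∈ range n, p' k = 1 ∧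
      (∀ t : ℝ, |t| ≤ l → |Real.log (∑ k ∈ range n, p' k * Real.exp (t * x k)) - Real.log (∑ k ∈ range n, p k * Real.exp (t * x k))| ≤ ε) ∧
      C * ε / l < |∑ k ∈ range n, (p' k - p k) * x k| := by
  -- an odd `N` with `N > 18 C`, then `η` at the admissibility threshold
  obtain ⟨m, hm⟩ := exists_nat_gt (18 * C)
  set N : ℕ := 2 * m + 1 with hNdef
  have hN : Odd N := ⟨m, by rw [hNdef]⟩
  have hNpos : 0 < N := hN.pos
  have hNr : (0 : ℝ) < N := Nat.cast_pos.mpr hNpos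
  have hmN : (m : ℝ) ≤ N := by rw [hNdef]; push_cast; linarith
  set h : ℝ := Real.exp (l / N) - 1 with hhdef
  have hh : 0 < h := expm1_pos hl hNpos
  set B : ℝ := 2 * (N + 1) * (4 / h + 1) ^ N with hB
  have hBpos : 0 < B := by positivity
  set η : ℝ := 1 / B with hηdef
  have hη : 0 < η := by positivity
  have hηN : 2 * η * (N + 1) * (4 / (Real.exp (l / N) - 1) + 1) ^ N ≤ 1 := by
    rw [← hhdef, hηdef]
    have : 2 * (1 / B) * (N + 1) * (4 / h + 1) ^ N = 1 := by rw [hB]; field_simp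
    rw [this]
  obtain ⟨x, p, p', hx, hpos, hs, hs', hcgf, -, hmean⟩ := cgf_log_loss_witness hl hl1 hN hη hηN
  refine ⟨N + 1, x, p, p', 6 * η, by positivity, hx, hpos, hs, hs', hcgf, ?_⟩
  rw [hmean]
  have hs1 : l / N ≤ 1 := (div_le_one hNr).mpr (hl1.trans (by exact_mod_cast hNpos))
  have h1 := inv_expm1_ge (div_pos hl hNr) hs1
  rw [← hhdef] at h1
  -- `C·6η∕l < η∕h`: `1∕h ≥ N∕(3l)` and `N > 18C`
  have h2 : (N : ℝ) / (3 * l) ≤ 1 / h := by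
    have e : 1 / (3 * (l / N)) = N / (3 * l) := by field_simp
    rw [← e]; exact h1
  have h3 : 18 * C < N := hm.trans_le hmN
  calc C * (6 * η) / l = η * (18 * C / (3 * l)) := by field_simp; ring
    _ < η * (N / (3 * l)) := by
        apply mul_lt_mul_of_pos_left _ hη
        exact div_lt_div_of_pos_right h3 (by positivity)
    _ ≤ η * (1 / h) := mul_le_mul_of_nonneg_left h2 hη.le
    _ = η / h := by rw [mul_one_div]

end Laws

end Summit.QuantumFields.BalabanUV.T4Continuum.NE9.DirectPairingApexCGFSharpLaws
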